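import Literature.Topology.FourManifolds.CylinderCobordism
import Literature.Topology.FourManifolds.HomotopySpheres
import Literature.Topology.FourManifolds.CerfGammaFourProofs
import HarnessLib

/-!
# Diffeomorphic closed manifolds are h-cobordant (Kervaire–Milnor 1963, §1)

Topic `Literature/Topology/FourManifolds`. Kervaire–Milnor, *Groups of homotopy spheres I*, Ann. of
Math. 77 (1963), §1: "the relation of h-cobordism is reflexive …; it is implied by diffeomorphism"
(attach the second manifold to the far end of the cylinder `M × [0, 1]` via the diffeomorphism).
With the cylinder cobordism of `CylinderCobordism.lean` (`Literature.Topology.FourManifolds.isHCobordant_self`) this file proves: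

* `Literature.Cobordism.compDiffeomorphRight/Left`: transport of a tree `Cobordism` along
  diffeomorphisms of its ends (precompose the end embeddings; a smooth embedding precomposed with
  a diffeomorphism is a smooth embedding, `Manifold.IsSmoothEmbedding.comp_diffeomorph`), and
  `IsHCobordism` is preserved (a homotopy equivalence precomposed with a homeomorphism is one);
* `Literature.IsCobordant.of_diffeomorph_right/left`, `Literature.IsHCobordant.of_diffeomorph_right/left`;
* `Literature.Topology.FourManifolds.isHCobordant_of_diffeomorph`: diffeomorphic closed smooth `n`-manifolds are h-cobordant;
* **discharge** of the tree fact `Literature.Topology.FourManifolds.HomotopySphere.isHCobordant_of_isOrientedDiffeomorphic`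
  (`HomotopySpheres.lean`): oriented-diffeomorphic homotopy spheres are h-cobordant
  (`HomotopySphere.isHCobordant_of_isOrientedDiffeomorphic_holds`).

## References

* M. Kervaire, J. Milnor, *Groups of homotopy spheres I*, Ann. of Math. 77 (1963), §1.
  [KervaireMilnorAnnals1963]
* J. Milnor, *Lectures on the h-cobordism theorem* (1965), §1. [MilnorHCobordism1965]
-/

open scoped Manifold ContDiff Topology ContinuousMap
open Set Function

noncomputable section

universe u

namespace Literature.Topology.FourManifolds

/-- Local notation: `𝔼 n` is the model Euclidean space `EuclideanSpace ℝ (Fin n)`. -/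
local notation "𝔼 " n:arg => EuclideanSpace ℝ (Fin n)

/-! ### Homotopy equivalences and homeomorphisms -/

/-- A homotopy equivalence (tree predicate `IsHomotopyEquiv`: the map underlies a
`ContinuousMap.HomotopyEquiv`) precomposed with a homeomorphism is a homotopy equivalence.
[folklore] -/
theorem IsHomotopyEquiv.comp_homeomorph {X Y Z : Type*} [TopologicalSpace X] [TopologicalSpace Y]
    [TopologicalSpace Z] {f : Y → Z} (hf : IsHomotopyEquiv f) (φ : X ≃ₜ Y) :
    IsHomotopyEquiv (f ∘ φ) := by
  obtain ⟨e, he⟩ := hf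
  exact ⟨φ.toHomotopyEquiv.trans e, by rw [← he]; rfl⟩

/-! ### Transport of cobordisms along diffeomorphisms of the ends -/

namespace Cobordism

variable {n : ℕ} {M N M' N' : Type u} [TopologicalSpace M] [ChartedSpace (𝔼 n) M]
  [TopologicalSpace N] [ChartedSpace (𝔼 n) N] [TopologicalSpace M'] [ChartedSpace (𝔼 n) M']
  [TopologicalSpace N'] [ChartedSpace (𝔼 n) N']

/-- **Transport of a cobordism along a diffeomorphism of the outgoing end**: if `(W; M, N)` is a
cobordism and `φ : N' ≅ N` a diffeomorphism, then `(W; M, N')` with `inr ∘ φ` is a cobordism (same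
total space). Kervaire–Milnor 1963, §1 ("implied by diffeomorphism"); Milnor 1965, §1.
[cite: KervaireMilnorAnnals1963, §1] -/
def compDiffeomorphRight [IsManifold (𝓡 n) ∞ N] [IsManifold (𝓡 n) ∞ N'] (c : Cobordism n M N)
    (φ : N' ≃ₘ⟮𝓡 n, 𝓡 n⟯ N) : Cobordism n M N' where
  W := c.W
  inl := c.inl
  inr := c.inr ∘ φ
  isSmoothEmbedding_inl := c.isSmoothEmbedding_inl
  isSmoothEmbedding_inr := c.isSmoothEmbedding_inr.comp_diffeomorph φ
  disjoint_range := by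
    rw [(EquivLike.surjective φ).range_comp]; exact c.disjoint_range
  range_inl_union_range_inr := by
    rw [(EquivLike.surjective φ).range_comp]; exact c.range_inl_union_range_inr

/-- The total space is unchanged by transport along a diffeomorphism of the outgoing end.
[folklore] -/
@[simp] theorem compDiffeomorphRight_W [IsManifold (𝓡 n) ∞ N] [IsManifold (𝓡 n) ∞ N']
    (c : Cobordism n M N) (φ : N' ≃ₘ⟮𝓡 n, 𝓡 n⟯ N) : (c.compDiffeomorphRight φ).W = c.W := rfl

/-- **Transport of a cobordism along a diffeomorphism of the incoming end** (`inl ∘ φ`).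
[cite: KervaireMilnorAnnals1963, §1] -/
def compDiffeomorphLeft [IsManifold (𝓡 n) ∞ M] [IsManifold (𝓡 n) ∞ M'] (c : Cobordism n M N)
    (φ : M' ≃ₘ⟮𝓡 n, 𝓡 n⟯ M) : Cobordism n M' N :=
  ((c.symm).compDiffeomorphRight φ).symm

/-- Transport along a diffeomorphism of the outgoing end preserves h-cobordisms: `inr ∘ φ` is a
homotopy equivalence if `inr` is (`IsHomotopyEquiv.comp_homeomorph`). [cite: KervaireMilnorAnnals1963, §1] -/
theorem IsHCobordism.compDiffeomorphRight [IsManifold (𝓡 n) ∞ N] [IsManifold (𝓡 n) ∞ N']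
    {c : Cobordism n M N} (h : c.IsHCobordism) (φ : N' ≃ₘ⟮𝓡 n, 𝓡 n⟯ N) :
    (c.compDiffeomorphRight φ).IsHCobordism :=
  ⟨h.1, h.2.comp_homeomorph φ.toHomeomorph⟩

/-- Transport along a diffeomorphism of the incoming end preserves h-cobordisms.
[cite: KervaireMilnorAnnals1963, §1] -/
theorem IsHCobordism.compDiffeomorphLeft [IsManifold (𝓡 n) ∞ M] [IsManifold (𝓡 n) ∞ M']
    {c : Cobordism n M N} (h : c.IsHCobordism) (φ : M' ≃ₘ⟮𝓡 n, 𝓡 n⟯ M) :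
    (c.compDiffeomorphLeft φ).IsHCobordism :=
  (h.symm.compDiffeomorphRight φ).symm

end Cobordism

section Transport

variable {n : ℕ} {M N M' N' : Type u} [TopologicalSpace M] [ChartedSpace (𝔼 n) M]
  [TopologicalSpace N] [ChartedSpace (𝔼 n) N] [TopologicalSpace M'] [ChartedSpace (𝔼 n) M']
  [TopologicalSpace N'] [ChartedSpace (𝔼 n) N']

/-- Cobordism is invariant under diffeomorphism of the outgoing end (Milnor 1965, §1).
[cite: MilnorHCobordism1965, §1] -/
theorem IsCobordant.of_diffeomorph_right [IsManifold (𝓡 n) ∞ N] [IsManifold (𝓡 n) ∞ N']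
    (h : IsCobordant n M N) (φ : N' ≃ₘ⟮𝓡 n, 𝓡 n⟯ N) : IsCobordant n M N' :=
  h.map fun c => c.compDiffeomorphRight φ

/-- Cobordism is invariant under diffeomorphism of the incoming end (Milnor 1965, §1).
[cite: MilnorHCobordism1965, §1] -/
theorem IsCobordant.of_diffeomorph_left [IsManifold (𝓡 n) ∞ M] [IsManifold (𝓡 n) ∞ M']
    (h : IsCobordant n M N) (φ : M' ≃ₘ⟮𝓡 n, 𝓡 n⟯ M) : IsCobordant n M' N :=
  h.map fun c => c.compDiffeomorphLeft φ

/-- h-cobordism is invariant under diffeomorphism of the outgoing end (Kervaire–Milnor 1963, §1).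
[cite: KervaireMilnorAnnals1963, §1] -/
theorem IsHCobordant.of_diffeomorph_right [IsManifold (𝓡 n) ∞ N] [IsManifold (𝓡 n) ∞ N']
    (h : IsHCobordant n M N) (φ : N' ≃ₘ⟮𝓡 n, 𝓡 n⟯ N) : IsHCobordant n M N' := by
  obtain ⟨c, hc⟩ := h
  exact ⟨c.compDiffeomorphRight φ, hc.compDiffeomorphRight φ⟩

/-- h-cobordism is invariant under diffeomorphism of the incoming end (Kervaire–Milnor 1963, §1).
[cite: KervaireMilnorAnnals1963, §1] -/
theorem IsHCobordant.of_diffeomorph_left [IsManifold (𝓡 n) ∞ M] [IsManifold (𝓡 n) ∞ M']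
    (h : IsHCobordant n M N) (φ : M' ≃ₘ⟮𝓡 n, 𝓡 n⟯ M) : IsHCobordant n M' N := by
  obtain ⟨c, hc⟩ := h
  exact ⟨c.compDiffeomorphLeft φ, hc.compDiffeomorphLeft φ⟩

/-- **Diffeomorphic closed smooth manifolds are h-cobordant** (Kervaire–Milnor, *Groups of
homotopy spheres I* (1963), §1: h-cobordism "is implied by diffeomorphism"): the cylinder
`M × [0, 1]` with `N` attached at the far end via the diffeomorphism
(`isHCobordant_self`, `IsHCobordant.of_diffeomorph_right`). [cite: KervaireMilnorAnnals1963, §1] -/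
theorem isHCobordant_of_diffeomorph [T2Space M] [SecondCountableTopology M] [IsManifold (𝓡 n) ∞ M]
    [CompactSpace M] [IsManifold (𝓡 n) ∞ N] (φ : M ≃ₘ⟮𝓡 n, 𝓡 n⟯ N) : IsHCobordant n M N :=
  (isHCobordant_self n M).of_diffeomorph_right φ.symm

/-- Diffeomorphic closed smooth manifolds are cobordant (Milnor 1965, §1). [cite: MilnorHCobordism1965, §1] -/
theorem isCobordant_of_diffeomorph [T2Space M] [SecondCountableTopology M] [IsManifold (𝓡 n) ∞ M]
    [CompactSpace M] [IsManifold (𝓡 n) ∞ N] (φ : M ≃ₘ⟮𝓡 n, 𝓡 n⟯ N) : IsCobordant n M N :=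
  (isHCobordant_of_diffeomorph φ).isCobordant

end Transport

/-! ### Discharge: oriented-diffeomorphic homotopy spheres are h-cobordant -/

namespace HomotopySphere

variable {n : ℕ}

/-- **Discharge of `HomotopySphere.isHCobordant_of_isOrientedDiffeomorphic`** (`HomotopySpheres.lean`;
Kervaire–Milnor, *Groups of homotopy spheres I* (1963), §1: "the relation of h-cobordism is
implied by diffeomorphism"): oriented-diffeomorphic homotopy spheres are h-cobordant — forget the
orientation condition and apply `isHCobordant_of_diffeomorph` (the cylinder with the second
sphere attached by the diffeomorphism). [cite: KervaireMilnorAnnals1963, §1] -/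
theorem isHCobordant_of_isOrientedDiffeomorphic_holds :
    isHCobordant_of_isOrientedDiffeomorphic (n := n) := by
  intro S T h
  obtain ⟨φ, -⟩ := h
  exact isHCobordant_of_diffeomorph φ

/-- Diffeomorphic homotopy spheres are h-cobordant, whatever the orientations
(Kervaire–Milnor 1963, §1). [cite: KervaireMilnorAnnals1963, §1] -/
theorem isHCobordant_of_nonempty_diffeomorph (S T : HomotopySphere n)
    (h : Nonempty (S.carrier ≃ₘ⟮𝓡 n, 𝓡 n⟯ T.carrier)) : S.IsHCobordant T := by
  obtain ⟨φ⟩ := h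
  exact isHCobordant_of_diffeomorph φ

/-- Every homotopy sphere is h-cobordant to itself (Kervaire–Milnor 1963, §1: reflexivity).
[cite: KervaireMilnorAnnals1963, §1] -/
theorem isHCobordant_refl (S : HomotopySphere n) : S.IsHCobordant S :=
  isHCobordant_self n S.carrier

end HomotopySphere

end Literature.Topology.FourManifolds
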